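import Summits.Ventures.Crystal3D.Bulk.GapTightHullEdges
import Summits.Ventures.Crystal3D.Bulk.GapHemisphere
import Summits.Ventures.Crystal3D.Bulk.GapExtremal
import Literature.Geometry.DiscreteGeometry.SphericalCodeHullEulerFormula
import HarnessLib

/-!
# The tight map inside the Delaunay subdivision of the thirteen directions: the direction set,
# Euler's formula for its hull, and tight pairs as hull edges in the tree's `hullEdges`
# vocabulary (`phase2/LEAN-FACES-DESIGN.md` §5.3 (G2)/(G3), first brick)

HONEST FRAMING. Part of the venture `Summits/Ventures/Crystal3D` (cell `pub-crystal3d`, phase 2;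
seat typer-bulk-2). The plan for Euler's formula / planarity of the ORIENTED tight map
(LEAN-FACES-DESIGN §5.3) realises the tight map as a sub-rotation-system of the hull (spherical
Delaunay) subdivision of the thirteen directions `gapDir c j`, `j ≠ 0`, whose face theory is the
tree's `Literature…ConvexHullFacets` / `SphericalCodeHull*` (facets, `hullEdges`, Euler
`#hullEdges + 2 = #X + #facets`). THIS file sets the hull side up in the cell's vocabulary:

* `dirSet c` — the finset of the thirteen directions; `IsGapConfig.card_dirSet` (`= 13`,
  `D < 2`), `IsGapConfig.norm_of_mem_dirSet`, `IsGapConfig.zero_mem_interior_convexHull_dirSet`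
  (from `Bulk/GapHemisphere.lean`: already the twelve shell directions surround `0`) — i.e. the
  standing hypotheses of the tree's hull-face theory hold for `dirSet c`;
* `IsGapConfig.euler_dirSet` — Euler's formula for the hull of the directions:
  `#hullEdges (dirSet c) + 2 = 13 + #facetNormals (dirSet c)`, and `#hullEdges ≤ 33`;
* **`IsGapConfig.pair_mem_hullEdges_of_tight`** — every tight pair `{i, j}` gives the hull edge
  `{gapDir c i, gapDir c j} ∈ hullEdges (dirSet c)` (the functional of `Bulk/GapTightHullEdges`
  normalised to an edge normal: T2 Lemma 16.1 in the tree's own hull vocabulary, `D < 3/2`);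
  `IsGapConfig.tightCount_le_card_hullEdges` (the tight pairs inject into the hull edges).

Nothing is claimed about GAP(1.26); the hull ROTATION system, its identification with the
oriented tight rotation, and Euler for the tight map are NOT here.
-/

noncomputable section

open scoped BigOperators InnerProductSpace RealInnerProductSpace
open Finset Real

namespace Summit.Ventures.Crystal3D

open Literature.Geometry.DiscreteGeometry

variable {c : Fin 14 → EuclideanSpace ℝ (Fin 3)}

/-! ## The thirteen directions as a finset -/

/-- **The direction set**: the thirteen unit directions `gapDir c j`, `j ≠ 0`, of the balls seen
from ball `0` (twelve shell directions and the hole direction). -/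
def dirSet (c : Fin 14 → EuclideanSpace ℝ (Fin 3)) : Finset (EuclideanSpace ℝ (Fin 3)) :=
  (univ.filter fun j : Fin 14 => j ≠ 0).image (gapDir c)

/-- Membership in `dirSet`. -/
theorem mem_dirSet {y : EuclideanSpace ℝ (Fin 3)} :
    y ∈ dirSet c ↔ ∃ j : Fin 14, j ≠ 0 ∧ gapDir c j = y := by
  unfold dirSet
  simp only [Finset.mem_image, Finset.mem_filter, Finset.mem_univ, true_and]

/-- Each direction is in the direction set. -/
theorem gapDir_mem_dirSet {j : Fin 14} (hj0 : j ≠ 0) : gapDir c j ∈ dirSet c :=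
  mem_dirSet.2 ⟨j, hj0, rfl⟩

/-- The directions are unit vectors. -/
theorem IsGapConfig.norm_of_mem_dirSet (hc : IsGapConfig c) :
    ∀ y ∈ dirSet c, ‖y‖ = 1 := by
  intro y hy
  obtain ⟨j, hj0, rfl⟩ := mem_dirSet.1 hy
  exact hc.norm_gapDir hj0

/-- There are thirteen labels `≠ 0`. -/
theorem card_filter_ne_zero : (univ.filter fun j : Fin 14 => j ≠ 0).card = 13 := by decide

/-- **The direction set has thirteen elements** (window `intruderDist c < 2`: distinct balls have
distinct directions). -/
theorem IsGapConfig.card_dirSet (hc : IsGapConfig c) (hD : intruderDist c < 2) :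
    (dirSet c).card = 13 := by
  classical
  unfold dirSet
  rw [Finset.card_image_of_injOn, card_filter_ne_zero]
  intro j hj k hk h
  rw [Finset.mem_coe, Finset.mem_filter] at hj hk
  by_contra hjk
  exact hc.gapDir_ne hD hj.2 hk.2 hjk h

/-- The twelve shell vectors are among the directions. -/
theorem IsGapConfig.shell_subset_dirSet (hc : IsGapConfig c) :
    ((univ.filter fun j : Fin 14 => j ≠ 0 ∧ j ≠ 13).image fun j => c j - c 0) ⊆ dirSet c := by
  intro y hy
  obtain ⟨j, hj, rfl⟩ := Finset.mem_image.1 hy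
  obtain ⟨hj0, hj13⟩ := (Finset.mem_filter.1 hj).2
  rw [← hc.gapDir_of_shell hj0 hj13]
  exact gapDir_mem_dirSet hj0

/-- **`0` is an interior point of the hull of the directions** (already the twelve shell
directions surround it, `Bulk/GapHemisphere.lean`): the standing hypothesis of the tree's
hull-face theory. -/
theorem IsGapConfig.zero_mem_interior_convexHull_dirSet (hc : IsGapConfig c) :
    (0 : EuclideanSpace ℝ (Fin 3)) ∈
      interior (convexHull ℝ (dirSet c : Set (EuclideanSpace ℝ (Fin 3)))) :=
  interior_mono (convexHull_mono (Finset.coe_subset.2 hc.shell_subset_dirSet))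
    hc.zero_mem_interior_convexHull_shell

/-! ## Euler's formula for the hull of the directions -/

/-- **Euler's formula for the hull (Delaunay subdivision) of the thirteen directions**:
`#hullEdges + 2 = 13 + #facets` (tree `euler_formula`; window `D < 2`). -/
theorem IsGapConfig.euler_dirSet (hc : IsGapConfig c) (hD : intruderDist c < 2) :
    (hullEdges (dirSet c)).card + 2 = 13 + (facetNormals (dirSet c)).card := by
  rw [← hc.card_dirSet hD]
  exact euler_formula hc.norm_of_mem_dirSet hc.zero_mem_interior_convexHull_dirSet

/-- The hull of the directions has at most `33 = 3·13 − 6` edges (tree `card_hullEdges_le`). -/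
theorem IsGapConfig.card_hullEdges_dirSet_le (hc : IsGapConfig c) (hD : intruderDist c < 2) :
    (hullEdges (dirSet c)).card ≤ 33 := by
  have h := card_hullEdges_le hc.norm_of_mem_dirSet hc.zero_mem_interior_convexHull_dirSet
  rw [hc.card_dirSet hD] at h
  omega

/-! ## Tight pairs are hull edges (T2 Lemma 16.1 in the tree's vocabulary) -/

/-- **Every tight pair spans a hull edge of the direction set.** For an admissible configuration
with `intruderDist c < 3/2` and balls `i, j ≠ 0` at distance `1`:
`{gapDir c i, gapDir c j} ∈ hullEdges (dirSet c)`, exposed by the edge normal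
`M⁻¹ • (gapDir c i + gapDir c j)`, `M = 1 + tightLevel c i j` (`Bulk/GapTightHullEdges.lean`). -/
theorem IsGapConfig.pair_mem_hullEdges_of_tight (hc : IsGapConfig c) (hD : intruderDist c < 3 / 2)
    {i j : Fin 14} (hi0 : i ≠ 0) (hj0 : j ≠ 0) (hij : dist (c i) (c j) = 1) :
    ({gapDir c i, gapDir c j} : Finset (EuclideanSpace ℝ (Fin 3))) ∈ hullEdges (dirSet c) := by
  classical
  have hD2 : intruderDist c < 2 := by linarith
  have hne := index_ne_of_dist_eq_one hij
  set m := gapDir c i + gapDir c j with hm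
  set M := ⟪m, gapDir c i⟫_ℝ with hM
  -- `M = 1 + tightLevel > 0`
  have hii : ⟪gapDir c i, gapDir c i⟫_ℝ = 1 := by
    rw [real_inner_self_eq_norm_sq, hc.norm_gapDir hi0]; norm_num
  have hMval : M = 1 + tightLevel c i j := by
    rw [hM, hm, inner_add_left, hii, real_inner_comm, hc.inner_gapDir_eq hi0 hj0 hij]
  have hMpos : 0 < M := by rw [hMval]; linarith [hc.half_le_tightLevel i j]
  set c₀ := M⁻¹ • m with hc₀
  have hval : ∀ y, ⟪c₀, y⟫_ℝ = M⁻¹ * ⟪m, y⟫_ℝ := fun y => by rw [hc₀, real_inner_smul_left]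
  have hi1 : ⟪c₀, gapDir c i⟫_ℝ = 1 := by rw [hval, ← hM, inv_mul_cancel₀ hMpos.ne']
  have hj1 : ⟪c₀, gapDir c j⟫_ℝ = 1 := by
    rw [hval, ← hc.inner_add_eq_of_tight hi0 hj0, ← hM, inv_mul_cancel₀ hMpos.ne']
  have hlt : ∀ k : Fin 14, k ≠ 0 → k ≠ i → k ≠ j → ⟪c₀, gapDir c k⟫_ℝ < 1 := by
    intro k hk0 hki hkj
    rw [hval]
    have h := hc.inner_add_lt_of_tight hD hi0 hj0 hk0 hij hki hkj
    rw [← hm, ← hM] at h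
    calc M⁻¹ * ⟪m, gapDir c k⟫_ℝ < M⁻¹ * M := mul_lt_mul_of_pos_left h (inv_pos.2 hMpos)
      _ = 1 := inv_mul_cancel₀ hMpos.ne'
  -- the tight set of `c₀` is exactly the pair
  have htight : tightSet (dirSet c) c₀ = {gapDir c i, gapDir c j} := by
    ext y
    rw [mem_tightSet, mem_dirSet, Finset.mem_insert, Finset.mem_singleton]
    constructor
    · rintro ⟨⟨k, hk0, rfl⟩, hy1⟩
      by_cases hki : k = i
      · exact Or.inl (by rw [hki])
      by_cases hkj : k = j
      · exact Or.inr (by rw [hkj])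
      exact absurd hy1 (hlt k hk0 hki hkj).ne
    · rintro (rfl | rfl)
      · exact ⟨⟨i, hi0, rfl⟩, hi1⟩
      · exact ⟨⟨j, hj0, rfl⟩, hj1⟩
  refine mem_hullEdges.2 ⟨c₀, ⟨?_, ?_⟩, htight⟩
  · intro y hy
    obtain ⟨k, hk0, rfl⟩ := mem_dirSet.1 hy
    by_cases hki : k = i
    · rw [hki, hi1]
    by_cases hkj : k = j
    · rw [hkj, hj1]
    exact (hlt k hk0 hki hkj).le
  · rw [htight, Finset.card_pair (hc.gapDir_ne hD2 hi0 hj0 hne)]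

/-- **The tight pairs inject into the hull edges**: `tightCount c ≤ #hullEdges (dirSet c)`
(`D < 3/2`). -/
theorem IsGapConfig.tightCount_le_card_hullEdges (hc : IsGapConfig c) (hD : intruderDist c < 3 / 2) :
    tightCount c ≤ (hullEdges (dirSet c)).card := by
  classical
  have hD2 : intruderDist c < 2 := by linarith
  unfold tightCount
  refine Finset.card_le_card_of_injOn (fun q => ({gapDir c q.1, gapDir c q.2} : Finset _))
    ?_ ?_
  · intro q hq
    rw [Finset.mem_coe, Finset.mem_filter] at hq
    obtain ⟨-, hq1, hlt, hd⟩ := hq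
    have hq2 : q.2 ≠ 0 := by
      intro h; rw [h] at hlt; exact absurd hlt (not_lt.2 (Fin.zero_le _))
    exact Finset.mem_coe.2 (hc.pair_mem_hullEdges_of_tight hD hq1 hq2 hd)
  · intro q hq q' hq' h
    rw [Finset.mem_coe, Finset.mem_filter] at hq hq'
    obtain ⟨-, hq1, hlt, hd⟩ := hq
    obtain ⟨-, hq1', hlt', hd'⟩ := hq'
    have hq2 : q.2 ≠ 0 := by
      intro h0; rw [h0] at hlt; exact absurd hlt (not_lt.2 (Fin.zero_le _))
    have hq2' : q'.2 ≠ 0 := by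
      intro h0; rw [h0] at hlt'; exact absurd hlt' (not_lt.2 (Fin.zero_le _))
    -- equal pairs of directions ⇒ equal index pairs (directions are injective, pairs ordered)
    have hinj : ∀ {a b : Fin 14}, a ≠ 0 → b ≠ 0 → gapDir c a = gapDir c b → a = b := by
      intro a b ha hb hab
      by_contra hne
      exact hc.gapDir_ne hD2 ha hb hne hab
    have h' : ({gapDir c q.1, gapDir c q.2} : Finset _) = {gapDir c q'.1, gapDir c q'.2} := h
    have h1 : gapDir c q.1 ∈ ({gapDir c q'.1, gapDir c q'.2} : Finset _) := by
      rw [← h']; exact Finset.mem_insert_self _ _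
    have h2 : gapDir c q.2 ∈ ({gapDir c q'.1, gapDir c q'.2} : Finset _) := by
      rw [← h']; exact Finset.mem_insert_of_mem (Finset.mem_singleton_self _)
    rw [Finset.mem_insert, Finset.mem_singleton] at h1 h2
    rcases h1 with h1 | h1 <;> rcases h2 with h2 | h2
    · have e1 := hinj hq1 hq1' h1
      have e2 := hinj hq2 hq1' h2
      exact absurd (e1.trans e2.symm) (ne_of_lt hlt)
    · exact Prod.ext (hinj hq1 hq1' h1) (hinj hq2 hq2' h2)
    · have e1 := hinj hq1 hq2' h1
      have e2 := hinj hq2 hq1' h2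
      -- `q.1 = q'.2 > q'.1 = q.2 > q.1`: impossible
      rw [e1, e2] at hlt
      exact absurd (hlt.trans hlt') (lt_irrefl _)
    · have e1 := hinj hq1 hq2' h1
      have e2 := hinj hq2 hq2' h2
      exact absurd (e1.trans e2.symm) (ne_of_lt hlt)

/-- Hence at most `33` tight pairs (Euler's edge bound for the tight graph; `D < 3/2`). -/
theorem IsGapConfig.tightCount_le_33 (hc : IsGapConfig c) (hD : intruderDist c < 3 / 2) :
    tightCount c ≤ 33 :=
  (hc.tightCount_le_card_hullEdges hD).trans (hc.card_hullEdges_dirSet_le (by linarith))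

end Summit.Ventures.Crystal3D
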